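import Summits.QuantumFields.QCD.Theses.HeatSlicedQuarks
import Literature.MathematicalPhysics.QuantumLattice.WilsonFermionBlockAveraging
import Summits.QuantumFields.QCD.Theorems.HeatSlicedQuarksInterleavedHeatSliceFlowStubUnitaryDiagonalCovariance
import Summits.QuantumFields.QCD.Theorems.HeatSlicedQuarksSmallFieldUltracontractivityStubFreeKernelFourier

/-!
# Stub `stub_parametrixGaugeReduction` of line `Sketch` (crux `InterleavedHeatSliceFlow`, item stmt-QuantumFields-8891)

Gauge transport of the on-diagonal colour–spin block of the heat-kernel difference
`e^{-tH_U} − e^{-tH_1}`, `H_U = D_W(U)ᴴ D_W(U)` the positive Wilson operator over `SU(3)`-valued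
links (`ρ = fundamentalRep (Fin 3)`, `r = 1`) and `H_1` the free one (`U ≡ 1`).

For a gauge transformation `g : Λ → SU(3)` the landed covariance stub
`stub_unitaryDiagonalCovariance` gives `e^{-tH_{U^g}} = 𝒢(g) e^{-tH_U} 𝒢(g⁻¹)` with the gauge
rotation `𝒢(g) = gaugeRotation ρ (Fin 4) g = ⊕_x ρ(g x) ⊗ 1_spin`, so that the `(x,x)` block
transforms by conjugation with `ρ(g x) ⊗ 1`:
`(𝒢 M 𝒢')((x,a,α),(x,b,β)) = Σ_{a' b'} ρ(g x)_{a a'} M((x,a',α),(x,b',β)) ρ((g x)⁻¹)_{b' b}`.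
The free `(x,x)` block is a colour–spin scalar `δ_{(a,α),(b,β)} S` (landed
`stub_freeKernelFourier` of crux 8871, `freeCfg L = fun _ => 1` definitionally), hence invariant
under this conjugation (`ρ(g x) ρ((g x)⁻¹) = 1`).  Therefore
`(e^{-tH_{U^g}} − e^{-tH_1})((x,a,α),(x,b,β)) = Σ_{a' b'} ρ(g x)_{a a'} (e^{-tH_U} − e^{-tH_1})((x,a',α),(x,b',β)) ρ((g x)⁻¹)_{b' b}`
and the triangle inequality with `|ρ(h)_{ij}| ≤ 1` for unitary `ρ(h)`
(`entry_norm_bound_of_unitary`) bounds each entry for `U^g` by the sum of the moduli of the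
`3 × 3` colour entries for `U` at the same spins.  Pure theorem file (no definitions).
-/

namespace Summit.QuantumFields.QCD.Cruxes.InterleavedHeatSliceFlow.Sketch

open Literature.MathematicalPhysics.QuantumLattice Literature.MathematicalPhysics.QuantumFieldTheory
  Literature.Probability.LatticeModels
open Summit.QuantumFields.QCD.Theses.HeatSlicedQuarks
open scoped Matrix Kronecker ComplexConjugate

/-- Entries of the conjugate `𝒢(g) M 𝒢(g⁻¹)` of a fermion matrix by gauge rotations: on the block
of the sites `x, y` it is `(ρ(g x) ⊗ 1) M_{x y} (ρ((g y)⁻¹) ⊗ 1)`, i.e.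
`Σ_{a' b'} ρ(g x)_{a a'} M((x,a',α),(y,b',β)) ρ((g y)⁻¹)_{b' b}`. -/
private theorem parametrixGaugeReduction_conj_apply {X : Type*} [Fintype X] [DecidableEq X]
    {G : Type*} [Group G] {N : ℕ} (ρ : G →* Matrix (Fin N) (Fin N) ℂ) {σ : Type*} [Fintype σ]
    [DecidableEq σ] (g : X → G) (M : Matrix (X × Fin N × σ) (X × Fin N × σ) ℂ) (x y : X)
    (a b : Fin N) (α β : σ) :
    (gaugeRotation ρ σ g * M * gaugeRotation ρ σ g⁻¹) (x, a, α) (y, b, β) =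
      ∑ a', ∑ b', ρ (g x) a a' * M (x, a', α) (y, b', β) * ρ ((g y)⁻¹) b' b := by
  rw [mul_gaugeRotation_apply]
  simp_rw [gaugeRotation_mul_apply, Finset.sum_mul, Pi.inv_apply]
  exact Finset.sum_comm

/-- A colour–spin scalar block `δ_{(a,α),(b,β)} S` is invariant under conjugation by `P ⊗ 1`,
`Q ⊗ 1` whenever `P Q = 1`:
`Σ_{a' b'} P_{a a'} (δ_{(a',α),(b',β)} S) Q_{b' b} = δ_{αβ} S (P Q)_{a b} = δ_{(a,α),(b,β)} S`. -/
private theorem parametrixGaugeReduction_sum_ite {N : ℕ} {σ : Type*} [DecidableEq σ]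
    (P Q : Matrix (Fin N) (Fin N) ℂ) (hPQ : P * Q = 1) (S : ℂ) (α β : σ) (a b : Fin N) :
    ∑ a', ∑ b', P a a' * (if (a', α) = (b', β) then S else 0) * Q b' b =
      if (a, α) = (b, β) then S else 0 := by
  by_cases hαβ : α = β
  · have h1 : ∀ a' b' : Fin N, P a a' * (if (a', α) = (b', β) then S else 0) * Q b' b =
        if a' = b' then P a a' * S * Q b' b else 0 := by
      intro a' b'
      by_cases h : a' = b'
      · rw [if_pos h, if_pos (by rw [h, hαβ])]
      · rw [if_neg h, if_neg fun h' => h (Prod.mk.inj h').1, mul_zero, zero_mul]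
    have h2 : ∑ a', P a a' * S * Q a' b = S * (P * Q) a b := by
      rw [Matrix.mul_apply, Finset.mul_sum]
      exact Finset.sum_congr rfl fun a' _ => by ring
    simp only [h1, Finset.sum_ite_eq, Finset.mem_univ, if_true]
    rw [h2, hPQ, Matrix.one_apply]
    by_cases hab : a = b
    · rw [if_pos hab, if_pos (by rw [hab, hαβ]), mul_one]
    · rw [if_neg hab, if_neg fun h' => hab (Prod.mk.inj h').1, mul_zero]
  · have h1 : ∀ a' b' : Fin N, P a a' * (if (a', α) = (b', β) then S else 0) * Q b' b = 0 := by
      intro a' b'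
      rw [if_neg fun h' => hαβ (Prod.mk.inj h').2, mul_zero, zero_mul]
    simp only [h1, Finset.sum_const_zero]
    rw [if_neg fun h' => hαβ (Prod.mk.inj h').2]

/-- The transport inequality in abstract form: if the `(x,x)` block of `K₁` is a colour–spin scalar
and `ρ` is a representation by unitary matrices, then every entry of the `(x,x)` block of
`𝒢(g) K 𝒢(g⁻¹) − K₁` is bounded by the sum of the moduli of the colour entries (at the same spins)
of the `(x,x)` block of `K − K₁`. -/
private theorem parametrixGaugeReduction_norm_le {X : Type*} [Fintype X] [DecidableEq X]
    {G : Type*} [Group G] {N : ℕ} (ρ : G →* Matrix (Fin N) (Fin N) ℂ)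
    (hρ : ∀ h, ρ h ∈ Matrix.unitaryGroup (Fin N) ℂ) {σ : Type*} [Fintype σ] [DecidableEq σ]
    (g : X → G) (K K₁ : Matrix (X × Fin N × σ) (X × Fin N × σ) ℂ) (x : X) (α β : σ) (a b : Fin N)
    (hK₁ : ∃ S : ℂ, ∀ a' b' : Fin N, K₁ (x, a', α) (x, b', β) = if (a', α) = (b', β) then S else 0) :
    ‖(gaugeRotation ρ σ g * K * gaugeRotation ρ σ g⁻¹) (x, a, α) (x, b, β) - K₁ (x, a, α) (x, b, β)‖ ≤
      ∑ a', ∑ b', ‖K (x, a', α) (x, b', β) - K₁ (x, a', α) (x, b', β)‖ := by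
  obtain ⟨S, hS⟩ := hK₁
  have hPQ : ρ (g x) * ρ ((g x)⁻¹) = 1 := by rw [← map_mul, mul_inv_cancel, map_one]
  -- the free (scalar) block is invariant under the conjugation
  have hfree : (gaugeRotation ρ σ g * K₁ * gaugeRotation ρ σ g⁻¹) (x, a, α) (x, b, β) =
      K₁ (x, a, α) (x, b, β) := by
    rw [parametrixGaugeReduction_conj_apply]
    simp_rw [hS]
    exact parametrixGaugeReduction_sum_ite _ _ hPQ S α β a b
  have hsub : (gaugeRotation ρ σ g * K * gaugeRotation ρ σ g⁻¹) (x, a, α) (x, b, β) -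
      K₁ (x, a, α) (x, b, β) =
        (gaugeRotation ρ σ g * (K - K₁) * gaugeRotation ρ σ g⁻¹) (x, a, α) (x, b, β) := by
    rw [Matrix.mul_sub, Matrix.sub_mul, Matrix.sub_apply, hfree]
  rw [hsub, parametrixGaugeReduction_conj_apply]
  refine (norm_sum_le _ _).trans (Finset.sum_le_sum fun a' _ => (norm_sum_le _ _).trans
    (Finset.sum_le_sum fun b' _ => ?_))
  rw [norm_mul, norm_mul, Matrix.sub_apply]
  have h1 : ‖ρ (g x) a a'‖ ≤ 1 := entry_norm_bound_of_unitary (hρ _) _ _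
  have h2 : ‖ρ ((g x)⁻¹) b' b‖ ≤ 1 := entry_norm_bound_of_unitary (hρ _) _ _
  calc _ ≤ 1 * ‖K (x, a', α) (x, b', β) - K₁ (x, a', α) (x, b', β)‖ * 1 := by gcongr
    _ = _ := by rw [one_mul, mul_one]

/-- **Stub `stub_parametrixGaugeReduction`** (S/M; reshape r3; worker): `ParametrixGaugeReduction` written
out.  Proof: `stub_unitaryDiagonalCovariance` (landed, `…StubUnitaryDiagonalCovariance`) with `t := (t : ℂ)`;
`gaugeRotation ρ (Fin 4) g` acts on the `(x,x)` block by `ρ(g x)` on colour, identity on spin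
(`gaugeRotation`, `Matrix.of` entry formula; `(gaugeRotation g)⁻¹ = gaugeRotation g⁻¹` by
`gaugeRotation_mul_inv`); the free `(x,x)` block is `δ_ab δ_αβ · k` (`stub_freeKernelFourier` of crux
8871, landed in `…SmallFieldUltracontractivityStubFreeKernelFourier`, with `freeCfg L = fun _ => 1` by
`rfl`), hence invariant; `Finset` triangle inequality and `entry_norm_bound_of_unitary`.  Leans on: as named. -/
theorem stub_parametrixGaugeReduction :
    ∀ (L : ℕ) [NeZero L] (g : TorusSite 4 L → Matrix.specialUnitaryGroup (Fin 3) ℂ)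
      (U : GaugeConfig 4 L (Matrix.specialUnitaryGroup (Fin 3) ℂ)) (m t : ℝ) (x : TorusSite 4 L)
      (a b : Fin 3) (α β : Fin 4),
      ‖(NormedSpace.exp (-(t : ℂ) • ((wilsonDirac (fundamentalRep (Fin 3)) (gaugeTransform g U) m 1)ᴴ *
            wilsonDirac (fundamentalRep (Fin 3)) (gaugeTransform g U) m 1))) (x, a, α) (x, b, β) -
          (NormedSpace.exp (-(t : ℂ) •
            ((wilsonDirac (fundamentalRep (Fin 3))
                (fun _ : Edge 4 L => (1 : Matrix.specialUnitaryGroup (Fin 3) ℂ)) m 1)ᴴ *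
              wilsonDirac (fundamentalRep (Fin 3))
                (fun _ : Edge 4 L => (1 : Matrix.specialUnitaryGroup (Fin 3) ℂ)) m 1))) (x, a, α) (x, b, β)‖ ≤
        ∑ a' : Fin 3, ∑ b' : Fin 3,
          ‖(NormedSpace.exp (-(t : ℂ) • ((wilsonDirac (fundamentalRep (Fin 3)) U m 1)ᴴ *
            wilsonDirac (fundamentalRep (Fin 3)) U m 1))) (x, a', α) (x, b', β) -
            (NormedSpace.exp (-(t : ℂ) •
            ((wilsonDirac (fundamentalRep (Fin 3))
                (fun _ : Edge 4 L => (1 : Matrix.specialUnitaryGroup (Fin 3) ℂ)) m 1)ᴴ *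
              wilsonDirac (fundamentalRep (Fin 3))
                (fun _ : Edge 4 L => (1 : Matrix.specialUnitaryGroup (Fin 3) ℂ)) m 1))) (x, a', α) (x, b', β)‖ := by
  intro L _ g U m t x a b α β
  rw [stub_unitaryDiagonalCovariance L g U m (t : ℂ)]
  exact parametrixGaugeReduction_norm_le (fundamentalRep (Fin 3)) fundamentalRep_mem_unitaryGroup g _ _
    x α β a b ⟨_, fun a' b' =>
      Summit.QuantumFields.QCD.Cruxes.SmallFieldUltracontractivity.PointCentredAxialParabolic.stub_freeKernelFourier
        L m t x x a' b' α β⟩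

end Summit.QuantumFields.QCD.Cruxes.InterleavedHeatSliceFlow.Sketch
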